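import Mathlib
import Summits.CriticalPhenomena.CardyFormulaZ2.Cruxes.ParafermionToSLESixFamilies.Ideator2Sketch

/-!
# Triage r1/3 — `Sketch.FirstLemmaB : PrecompactFamilies → UniformPrecompact` holds (candidate proof)

Near-maximiser / diagonal-family argument, arranged so that NO a-priori bound on the observable is
needed: at each mesh either the ratio set is unbounded (pick a witness beating `1/δ`), or it has a
positive supremum (pick a witness beating half of it), or everything vanishes (use the given family).
-/

namespace Summit.CriticalPhenomena.CardyFormulaZ2.Cruxes.ParafermionToSLESixFamilies.Triage3

open scoped Topology
open Filter Set
open Literature.Probability.LatticeModels Literature.Probability.Percolation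
open Literature.Probability.RandomPlanarGeometry
open Sketch

/-- The set of normalised observable values `‖obs E z‖ / δ^{1/3}` over admissible data with carrier
`D` and mesh `δ` and lattice edges over `K`. -/
def ratioSet (D : DobrushinDomain) (K : Set ℂ) (δ : ℝ) : Set ℝ :=
  {r | ∃ (E : DiscreteDobrushin) (z : MedialVertex), E.Ω = D.carrier ∧ E.δ = δ ∧ E.IsZdAdmissible ∧
      z ∈ (zdGraph 2).edgeSet ∧ medialPoint δ z ∈ K ∧ r = ‖obs E z‖ / δ ^ ((1:ℝ) / 3)}

theorem mem_ratioSet {D : DobrushinDomain} {K : Set ℂ} {δ : ℝ} {E : DiscreteDobrushin}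
    {z : MedialVertex} (hΩ : E.Ω = D.carrier) (hδ : E.δ = δ) (hE : E.IsZdAdmissible)
    (hz : z ∈ (zdGraph 2).edgeSet) (hK : medialPoint δ z ∈ K) :
    ‖obs E z‖ / δ ^ ((1:ℝ) / 3) ∈ ratioSet D K δ :=
  ⟨E, z, hΩ, hδ, hE, hz, hK, rfl⟩

/-- `FirstLemmaB` of card `caratheodory-net-slit-uniformity` holds. -/
theorem firstLemmaB : FirstLemmaB := by
  intro hP D hΛ₀ K hK hKD
  obtain ⟨Λ₀, hΩ₀, hδ₀, hadm₀⟩ := hΛ₀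
  classical
  -- witnesses in the unbounded case
  have hU : ∀ δ, ¬ BddAbove (ratioSet D K δ) →
      ∃ E : DiscreteDobrushin, ∃ z : MedialVertex, E.Ω = D.carrier ∧ E.δ = δ ∧ E.IsZdAdmissible ∧
        z ∈ (zdGraph 2).edgeSet ∧ medialPoint δ z ∈ K ∧ 1 / δ < ‖obs E z‖ / δ ^ ((1:ℝ) / 3) := by
    intro δ h
    by_contra hcon
    refine h ⟨1 / δ, ?_⟩
    rintro r ⟨E, z, h1, h2, h3, h4, h5, rfl⟩
    exact le_of_not_gt fun hlt => hcon ⟨E, z, h1, h2, h3, h4, h5, hlt⟩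
  -- witnesses in the bounded, positive-sup case
  have hS : ∀ δ, BddAbove (ratioSet D K δ) → 0 < sSup (ratioSet D K δ) →
      ∃ E : DiscreteDobrushin, ∃ z : MedialVertex, E.Ω = D.carrier ∧ E.δ = δ ∧ E.IsZdAdmissible ∧
        z ∈ (zdGraph 2).edgeSet ∧ medialPoint δ z ∈ K ∧
        sSup (ratioSet D K δ) / 2 < ‖obs E z‖ / δ ^ ((1:ℝ) / 3) := by
    intro δ _ hpos
    have hne : (ratioSet D K δ).Nonempty := by
      by_contra h
      rw [Set.not_nonempty_iff_eq_empty] at h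
      rw [h, Real.sSup_empty] at hpos
      exact lt_irrefl _ hpos
    obtain ⟨r, ⟨E, z, h1, h2, h3, h4, h5, rfl⟩, hr⟩ :=
      exists_lt_of_lt_csSup hne (by linarith : sSup (ratioSet D K δ) / 2 < sSup (ratioSet D K δ))
    exact ⟨E, z, h1, h2, h3, h4, h5, hr⟩
  -- the diagonal family
  obtain ⟨Λ, hΛΩ, hΛδ, hΛadm, hΛU, hΛS⟩ : ∃ Λ : ℝ → DiscreteDobrushin,
      (∀ δ, (Λ δ).Ω = D.carrier) ∧ (∀ δ, (Λ δ).δ = δ) ∧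
      (∀ δ, (Λ₀ δ).IsZdAdmissible → (Λ δ).IsZdAdmissible) ∧
      (∀ δ, ¬ BddAbove (ratioSet D K δ) → ∃ z : MedialVertex, z ∈ (zdGraph 2).edgeSet ∧
          medialPoint δ z ∈ K ∧ 1 / δ < ‖obs (Λ δ) z‖ / δ ^ ((1:ℝ) / 3)) ∧
      (∀ δ, BddAbove (ratioSet D K δ) → 0 < sSup (ratioSet D K δ) → ∃ z : MedialVertex,
          z ∈ (zdGraph 2).edgeSet ∧ medialPoint δ z ∈ K ∧
          sSup (ratioSet D K δ) / 2 < ‖obs (Λ δ) z‖ / δ ^ ((1:ℝ) / 3)) := by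
    refine ⟨fun δ => if h : ¬ BddAbove (ratioSet D K δ) then (hU δ h).choose
        else if h' : 0 < sSup (ratioSet D K δ) then (hS δ (not_not.1 h) h').choose else Λ₀ δ,
      ?_, ?_, ?_, ?_, ?_⟩
    · intro δ
      dsimp only
      by_cases h : BddAbove (ratioSet D K δ)
      · by_cases h' : 0 < sSup (ratioSet D K δ)
        · rw [dif_neg (not_not.2 h), dif_pos h']
          exact (hS δ h h').choose_spec.choose_spec.1
        · rw [dif_neg (not_not.2 h), dif_neg h']
          exact hΩ₀ δ
      · rw [dif_pos h]
        exact (hU δ h).choose_spec.choose_spec.1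
    · intro δ
      dsimp only
      by_cases h : BddAbove (ratioSet D K δ)
      · by_cases h' : 0 < sSup (ratioSet D K δ)
        · rw [dif_neg (not_not.2 h), dif_pos h']
          exact (hS δ h h').choose_spec.choose_spec.2.1
        · rw [dif_neg (not_not.2 h), dif_neg h']
          exact hδ₀ δ
      · rw [dif_pos h]
        exact (hU δ h).choose_spec.choose_spec.2.1
    · intro δ h0
      dsimp only
      by_cases h : BddAbove (ratioSet D K δ)
      · by_cases h' : 0 < sSup (ratioSet D K δ)
        · rw [dif_neg (not_not.2 h), dif_pos h']
          exact (hS δ h h').choose_spec.choose_spec.2.2.1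
        · rw [dif_neg (not_not.2 h), dif_neg h']
          exact h0
      · rw [dif_pos h]
        exact (hU δ h).choose_spec.choose_spec.2.2.1
    · intro δ h
      dsimp only
      rw [dif_pos h]
      obtain ⟨-, -, -, h4, h5, h6⟩ := (hU δ h).choose_spec.choose_spec
      exact ⟨_, h4, h5, h6⟩
    · intro δ hb hpos
      dsimp only
      rw [dif_neg (not_not.2 hb), dif_pos hpos]
      obtain ⟨-, -, -, h4, h5, h6⟩ := (hS δ hb hpos).choose_spec.choose_spec
      exact ⟨_, h4, h5, h6⟩
  -- feed the diagonal family to the hypothesis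
  have hadm : ∀ᶠ δ in 𝓝[>] (0:ℝ), (Λ δ).IsZdAdmissible := by
    filter_upwards [hadm₀] with δ h using hΛadm δ h
  have hPΛ := hP D Λ hΛΩ hΛδ hadm
  simp only at hPΛ
  obtain ⟨⟨C₀, hC₀⟩, -⟩ := hPΛ K hK hKD
  -- obs (Λ δ) z is the `F δ z` of the hypothesis
  have hobs : ∀ δ z, obs (Λ δ) z = ∫ ω, passageSum (medialExploration (Λ δ) ω) δ (1 / 3) z
      ∂(bondPercolation (zdGraph 2) half) := by
    intro δ z
    rw [obs, hΛδ]
  refine ⟨2 * max C₀ 0, ?_⟩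
  have hpos : ∀ᶠ δ in 𝓝[>] (0:ℝ), 0 < δ := eventually_mem_nhdsWithin
  have hsmall : ∀ᶠ δ in 𝓝[>] (0:ℝ), δ < 1 / (max C₀ 0 + 1) :=
    mem_nhdsWithin_of_mem_nhds (Iio_mem_nhds (by positivity))
  filter_upwards [hC₀, hpos, hsmall] with δ hC hδ hδs
  intro E hEΩ hEδ hE z hz hzK
  have hδ3 : 0 < δ ^ ((1:ℝ) / 3) := Real.rpow_pos_of_pos hδ _
  have hmem : ‖obs E z‖ / δ ^ ((1:ℝ) / 3) ∈ ratioSet D K δ := mem_ratioSet hEΩ hEδ hE hz hzK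
  have hmax : C₀ ≤ max C₀ 0 := le_max_left _ _
  by_cases hb : BddAbove (ratioSet D K δ)
  · have hle : ‖obs E z‖ / δ ^ ((1:ℝ) / 3) ≤ sSup (ratioSet D K δ) := le_csSup hb hmem
    by_cases hsup : 0 < sSup (ratioSet D K δ)
    · obtain ⟨z', hz', hz'K, hlt⟩ := hΛS δ hb hsup
      have hb' : ‖obs (Λ δ) z'‖ ≤ C₀ * δ ^ ((1:ℝ) / 3) := by rw [hobs]; exact hC z' hz' hz'K
      have hr' : ‖obs (Λ δ) z'‖ / δ ^ ((1:ℝ) / 3) ≤ C₀ := by rwa [div_le_iff₀ hδ3]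
      have : ‖obs E z‖ / δ ^ ((1:ℝ) / 3) ≤ 2 * max C₀ 0 := by linarith
      rwa [div_le_iff₀ hδ3] at this
    · have hsup' : sSup (ratioSet D K δ) ≤ 0 := not_lt.1 hsup
      have : ‖obs E z‖ / δ ^ ((1:ℝ) / 3) ≤ 2 * max C₀ 0 := by
        linarith [le_max_right C₀ 0]
      rwa [div_le_iff₀ hδ3] at this
  · exfalso
    obtain ⟨z', hz', hz'K, hlt⟩ := hΛU δ hb
    have hb' : ‖obs (Λ δ) z'‖ ≤ C₀ * δ ^ ((1:ℝ) / 3) := by rw [hobs]; exact hC z' hz' hz'K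
    have hr' : ‖obs (Λ δ) z'‖ / δ ^ ((1:ℝ) / 3) ≤ C₀ := by rwa [div_le_iff₀ hδ3]
    have h1 : 1 / δ ≤ max C₀ 0 := by linarith
    have h2 : max C₀ 0 + 1 < 1 / δ := by
      rw [lt_div_iff₀ hδ]
      calc (max C₀ 0 + 1) * δ < (max C₀ 0 + 1) * (1 / (max C₀ 0 + 1)) := by
            apply mul_lt_mul_of_pos_left hδs (by positivity)
        _ = 1 := by field_simp
    linarith

end Summit.CriticalPhenomena.CardyFormulaZ2.Cruxes.ParafermionToSLESixFamilies.Triage3
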